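import Literature.MathematicalPhysics.QuantumLattice.PseudospinBondPairTriplet
import Literature.MathematicalPhysics.QuantumLattice.HubbardHalfFilledPseudospinSinglet
import HarnessLib

/-!
# Pseudospin selection rule: bond-singlet pair correlations = ½ × staggered bond-current
# correlations in every `η`-singlet, in particular in THE half-filled repulsive Hubbard ground state
# (Zhang 1990; Yang–Zhang 1990 — reproduction)

Ladder R1–R4 with certified numbers; no claim on H/H₀.

Trunk T-QLATTICE, family `hubbard`. Literature REPRODUCTION with citation header, built on the CAR
algebra of `FermionOperatorsProofs.lean`, on Zhang's triplet lowering step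
`PseudospinBondPairTriplet.lean` (`[η⁻, J_w] = -2 Δ_w`, `[η⁻, Δ_w] = 0`) and on the pseudospin-singlet
property of the half-filled ground state `HubbardHalfFilledPseudospinSinglet.lean`
(`η⁻ ψ = η⁺ ψ = 0`). No existing statement is changed; everything is a proved theorem, no named
fact, no `sorry`.

**What is reproduced.** S.-C. Zhang, *Pseudospin symmetry and new collective modes of the Hubbard
model*, Phys. Rev. Lett. **65** (1990) 120: under Yang's pseudospin `SU(2)` generated by
`η⁺ = Σ_z ε_z c†_{z↑} c†_{z↓}` (`etaRaise ε`), `η⁻ = (η⁺)†` (`etaLower ε`), `η^z = ½(N̂ - |Λ|)`, the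
singlet pair annihilator of a bond `(x, y)` joining opposite staggered signs,
`d_{xy} = c_{x↑} c_{y↓} - c_{x↓} c_{y↑}` (`bondPairAnn`), the sublattice-staggered bond current
`ε_x j_{xy}`, `j_{xy} = Σ_σ (c†_{xσ} c_{yσ} - c†_{yσ} c_{xσ})` (`bondCurrent`), and the pair creator
`d†_{xy}` form ONE pseudospin triplet (for the `d_{x²-y²}` form factor: R. S. Markiewicz,
M. T. Vaughn, J. Phys. Chem. Solids **59** (1998) 1737, p. 3, "a pseudospin triplet combining d-wave
superconductivity (`Δ_d`, `Δ_d†`) and an orbital antiferromagnet (`O_JC`) equivalent to the flux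
phase operator"). The tree already has the lowering step; this file adds the RAISING / MIDDLE step

* `etaLower_commutator_bondPairCre` — `[η⁻_ε, d†_{xy}] = -ε_x j_{xy}`,
* `etaRaise_commutator_bondPairAnn` — `[η⁺_ε, d_{xy}] = -ε_x j_{xy}` (its adjoint),
* `etaRaise_commutator_weightedPair` — `[η⁺_ε, Δ_w] = -J_w` for a weighted bond family
  `Δ_w = Σ_i w_i d_{x_i y_i}`, `J_w = Σ_i w_i ε_{x_i} j_{x_i y_i}` (any form factor `w`),

and draws the consequence for correlation functions (the Wigner–Eckart content of the triplet,
obtained here by three lines of operator algebra, no Casimir): in every vector `ψ` with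
`η⁻_ε ψ = 0` and `η⁺_ε ψ = 0` (a pseudospin singlet),

  `⟨Δ_w ψ, Δ_{w'} ψ⟩ = ½ ⟨J_w ψ, J_{w'} ψ⟩`   (`weightedPair_inner_eq_half_weightedCurrent_inner`),

bond by bond `⟨d_{xy} ψ, d_{x'y'} ψ⟩ = ½ ε_x ε_{x'} ⟨j_{xy} ψ, j_{x'y'} ψ⟩`
(`bondPair_inner_eq_half_bondCurrent_inner`), i.e. as ground-state expectations
`⟨ψ, d†_{xy} d_{x'y'} ψ⟩ = -½ ε_x ε_{x'} ⟨ψ, j_{xy} j_{x'y'} ψ⟩` (`expect_bondPairCre_mul_bondPairAnn`;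
`j† = -j`). Proof: `Δ_w ψ = -½ η⁻ J_w ψ` (lowering step, `η⁻ ψ = 0`), so
`⟨Δ_w ψ, Δ_{w'} ψ⟩ = ¼ ⟨J_w ψ, η⁺ η⁻ J_{w'} ψ⟩`, and `η⁺ η⁻ J_{w'} ψ = -2 η⁺ Δ_{w'} ψ = -2 [η⁺, Δ_{w'}] ψ
= 2 J_{w'} ψ` (raising step, `η⁺ ψ = 0`).

**The Hubbard ground state.** By Lieb's theorem and `HubbardHalfFilledPseudospinSinglet.lean`, THE
half-filled ground state of the repulsive Hubbard model (`U > 0`, `t ≠ 0`) on a connected bipartite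
graph with `|A| = |B|` is a pseudospin singlet for the bond-alternating sign `ε`; hence
(`groundState_weightedPair_inner_eq_half`, `groundState_bondPair_inner_eq_half`,
`hubbardTorus_groundState_weightedPair_inner_eq_half`, `hubbardTorus_groundState_bondPair_inner_eq_half`)
EVERY equal-time singlet-pair correlation function of that state — in particular the benchmark
`d_{x²-y²}` pair–pair correlator `P_d(r)` and the uniform `d`-wave pair structure factor of the
square torus `(ℤ/Lℤ)²`, `L` even, `t' = 0`, `n = 1` — equals one half of the corresponding
sublattice-staggered current–current correlator (the orbital-antiferromagnet / staggered-flux /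
`d`-density-wave correlator): at the particle–hole-symmetric corner of the phase diagram, `d`-wave
pairing and staggered-flux fluctuations are locked to each other exactly. No inequality, no
numerical input; the identity transports every certified statement about one observable to the
other.

## Sources

S.-C. Zhang, PRL **65** (1990) 120 [cite: Zhang1990]; C. N. Yang, S. C. Zhang, Mod. Phys. Lett. B
**4** (1990) 759, Theorem 1 [cite: YangZhang1990, Theorem 1]; R. S. Markiewicz, M. T. Vaughn,
J. Phys. Chem. Solids **59** (1998) 1737, p. 3 [cite: MarkiewiczVaughn1998, p. 3]; C. N. Yang, PRL
**63** (1989) 2144, eqs. (4)–(6) [cite: Yang1989, eq. (6)]; E. H. Lieb, PRL **62** (1989) 1201,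
Theorem 2 [cite: LiebPRL1989, proof of Theorem 2]; F. H. L. Essler et al., *The One-Dimensional
Hubbard Model* (CUP 2005) §2.2, eq. (2.72) [cite: EsslerEtAl2005, §2.2 eq. (2.72)].
-/

noncomputable section

namespace Literature.MathematicalPhysics.QuantumLattice

open Matrix Finset
open scoped ComplexOrder

/-! ### §0 CAR bookkeeping: a pair annihilator against a pair creator -/

section CAR

variable {ι : Type*} [LinearOrder ι] [Fintype ι]

/-- `[c_a c_b, c†_p c†_q] = δ_{ap} c†_q c_b + δ_{bq} c†_p c_a - δ_{ap} δ_{bq}` when `b ≠ p` and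
`a ≠ q`. Essler et al. (2005) §2.2, eq. (2.72) (private copy of the CAR bookkeeping of
`Theorems/WidthHaldaneColumnPairTriplet`, which Literature cannot import). [cite: EsslerEtAl2005, §2.2 eq. (2.72)] -/
private theorem annPair_commutator_crePair' {a b p q : ι} (hbp : b ≠ p) (haq : a ≠ q) :
    annihilation a * annihilation b * (creation p * creation q) -
        creation p * creation q * (annihilation a * annihilation b) =
      (if a = p then creation q * annihilation b else 0) +
        (if b = q then creation p * annihilation a else 0) -
        (if a = p then (if b = q then (1 : Matrix (Finset ι) (Finset ι) ℂ) else 0) else 0) := by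
  have h1 : annihilation a * annihilation b * (creation p * creation q) =
      -(((if a = p then (1 : Matrix (Finset ι) (Finset ι) ℂ) else 0) - creation p * annihilation a) *
        ((if b = q then (1 : Matrix (Finset ι) (Finset ι) ℂ) else 0) -
          creation q * annihilation b)) := by
    rw [← annihilation_mul_creation a p, ← annihilation_mul_creation b q]
    calc annihilation a * annihilation b * (creation p * creation q)
        = annihilation a * (annihilation b * creation p) * creation q := by simp only [mul_assoc]
      _ = _ := by
        rw [annihilation_mul_creation b p, if_neg hbp, zero_sub]
        simp only [mul_neg, neg_mul, mul_assoc]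
  have h2 : creation p * annihilation a * (creation q * annihilation b) =
      -(creation p * creation q * (annihilation a * annihilation b)) := by
    calc creation p * annihilation a * (creation q * annihilation b)
        = creation p * (annihilation a * creation q) * annihilation b := by simp only [mul_assoc]
      _ = _ := by
        rw [annihilation_mul_creation a q, if_neg haq, zero_sub]
        simp only [mul_neg, neg_mul, mul_assoc]
  rw [h1]
  split_ifs with hap hbq
  · simp only [mul_sub, sub_mul, one_mul, mul_one, h2]
    abel
  · simp only [mul_sub, sub_mul, mul_zero, one_mul, h2]
    abel
  · simp only [mul_sub, sub_mul, zero_mul, mul_one, h2]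
    abel
  · simp only [mul_sub, sub_mul, zero_mul, mul_zero, h2]
    abel

end CAR

section Hubbard

variable {Λ : Type*} [LinearOrder Λ] [Fintype Λ]

/-! ### §1 The raising / middle step of Zhang's triplet -/

omit [LinearOrder Λ] [Fintype Λ] in
/-- Sites of opposite stagger are distinct. [folklore] -/
private theorem ne_of_stagger_eq_neg (ε : Λ → ℤˣ) {x y : Λ} (hε : ε y = -ε x) : x ≠ y := by
  rintro rfl
  rcases Int.units_eq_one_or (ε x) with h | h <;> rw [h] at hε <;> simp at hε

/-- The singlet bond pair creator: `d†_{xy} = c†_{y↓} c†_{x↑} - c†_{y↑} c†_{x↓}` (Markiewicz–Vaughn's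
`Δ_d†`, bond by bond). [cite: MarkiewiczVaughn1998, p. 3] -/
theorem bondPairAnn_conjTranspose (x y : Λ) :
    (bondPairAnn x y)ᴴ =
      creation (orb y 1) * creation (orb x 0) - creation (orb y 0) * creation (orb x 1) := by
  simp only [bondPairAnn, conjTranspose_sub, conjTranspose_mul, annihilation_conjTranspose]

/-- The bond current without the factor `i` is anti-Hermitian, `j†_{xy} = -j_{xy}` (so that
Markiewicz–Vaughn's orbital antiferromagnet `O_JC ∝ i Σ ε j` is Hermitian). [cite: MarkiewiczVaughn1998, p. 3] -/
theorem bondCurrent_conjTranspose (x y : Λ) : (bondCurrent x y)ᴴ = -bondCurrent x y := by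
  simp only [bondCurrent, conjTranspose_sum, conjTranspose_sub, conjTranspose_mul,
    annihilation_conjTranspose, creation_conjTranspose, ← Finset.sum_neg_distrib, neg_sub]

/-- `[η⁻_ε, d†_{xy}] = ε_x Σ_σ (-c†_{xσ} c_{yσ} + c†_{yσ} c_{xσ})` for `ε_y = -ε_x`
(only `z ∈ {x, y}` of `η⁻ = Σ_z ε_z c_{z↓} c_{z↑}` contribute). Yang (1989) eqs. (4)–(5); Zhang
(1990). [cite: Zhang1990] -/
private theorem etaLower_commutator_bondPairCre_aux (ε : Λ → ℤˣ) {x y : Λ} (hε : ε y = -ε x) :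
    etaLower ε * (creation (orb y 1) * creation (orb x 0) - creation (orb y 0) * creation (orb x 1)) -
        (creation (orb y 1) * creation (orb x 0) - creation (orb y 0) * creation (orb x 1)) *
          etaLower ε =
      ((ε x : ℤ) : ℂ) • ∑ σ : Fin 2, ((-1 : ℂ) • (creation (orb x σ) * annihilation (orb y σ)) +
        (1 : ℂ) • (creation (orb y σ) * annihilation (orb x σ))) := by
  have hne : x ≠ y := ne_of_stagger_eq_neg ε hε
  have hne' : y ≠ x := hne.symm
  have hy : ((ε y : ℤ) : ℂ) = -((ε x : ℤ) : ℂ) := by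
    rw [hε, Units.val_neg, Int.cast_neg]
  have h10 : (1 : Fin 2) ≠ 0 := by decide
  have hB : ∀ z : Λ, annihilation (orb z 1) * annihilation (orb z 0) *
        (creation (orb y 0) * creation (orb x 1)) -
      creation (orb y 0) * creation (orb x 1) * (annihilation (orb z 1) * annihilation (orb z 0)) =
      -(annihilation (orb z 1) * annihilation (orb z 0) * (creation (orb x 1) * creation (orb y 0)) -
        creation (orb x 1) * creation (orb y 0) * (annihilation (orb z 1) * annihilation (orb z 0))) := by
    intro z
    rw [creation_mul_creation_eq_neg (orb y 0) (orb x 1)]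
    simp only [mul_neg, neg_mul, neg_sub_neg, neg_sub]
  have hterm : ∀ z : Λ,
      annihilation (orb z 1) * annihilation (orb z 0) *
            (creation (orb y 1) * creation (orb x 0) - creation (orb y 0) * creation (orb x 1)) -
          (creation (orb y 1) * creation (orb x 0) - creation (orb y 0) * creation (orb x 1)) *
            (annihilation (orb z 1) * annihilation (orb z 0)) =
        ((if z = y then creation (orb x 0) * annihilation (orb z 0) else 0) +
            (if z = x then creation (orb y 1) * annihilation (orb z 1) else 0) -
            (if z = y then (if z = x then (1 : Matrix _ _ ℂ) else 0) else 0)) +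
          ((if z = x then creation (orb y 0) * annihilation (orb z 0) else 0) +
            (if z = y then creation (orb x 1) * annihilation (orb z 1) else 0) -
            (if z = x then (if z = y then (1 : Matrix _ _ ℂ) else 0) else 0)) := by
    intro z
    rw [mul_sub, sub_mul, sub_sub_sub_comm, hB z, sub_neg_eq_add,
      annPair_commutator_crePair' (fun h => h10.symm (orb_eq_orb_iff.1 h).2)
        (fun h => h10 (orb_eq_orb_iff.1 h).2),
      annPair_commutator_crePair' (fun h => h10.symm (orb_eq_orb_iff.1 h).2)
        (fun h => h10 (orb_eq_orb_iff.1 h).2)]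
    simp only [orb_eq_orb_iff, and_true]
  rw [etaLower_eq_sum' ε, Finset.sum_mul, Finset.mul_sum, ← Finset.sum_sub_distrib]
  simp only [smul_mul_assoc, mul_smul_comm, ← smul_sub, hterm]
  simp only [smul_add, smul_sub, smul_ite, smul_zero, Finset.sum_add_distrib,
    Finset.sum_sub_distrib, Finset.sum_ite_eq', Finset.mem_univ, if_true, hne, hne', if_false,
    Fin.sum_univ_two, Fin.isValue]
  rw [hy]
  module

/-- **Middle step of Zhang's triplet, lowered from the top**: on a bond joining opposite staggered
signs (`ε_y = -ε_x`), `[η⁻_ε, d†_{xy}] = -ε_x j_{xy}` — the pseudospin lowering operator maps the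
singlet pair CREATOR onto the staggered bond current. Zhang (1990); Yang–Zhang (1990) Theorem 1.
[cite: Zhang1990] -/
theorem etaLower_commutator_bondPairCre (ε : Λ → ℤˣ) (x y : Λ) (hε : ε y = -ε x) :
    etaLower ε * (bondPairAnn x y)ᴴ - (bondPairAnn x y)ᴴ * etaLower ε =
      (-((ε x : ℤ) : ℂ)) • bondCurrent x y := by
  rw [bondPairAnn_conjTranspose, etaLower_commutator_bondPairCre_aux ε hε, bondCurrent,
    Finset.smul_sum, Finset.smul_sum]
  refine Finset.sum_congr rfl fun σ _ => ?_
  module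

/-- **Middle step of Zhang's triplet, raised from the bottom**: for `ε_y = -ε_x`,
`[η⁺_ε, d_{xy}] = -ε_x j_{xy}` — the pseudospin raising operator maps the singlet pair ANNIHILATOR
onto the staggered bond current (adjoint of `etaLower_commutator_bondPairCre`, `j† = -j`).
Zhang (1990); Markiewicz–Vaughn (1998) p. 3. [cite: Zhang1990] -/
theorem etaRaise_commutator_bondPairAnn (ε : Λ → ℤˣ) (x y : Λ) (hε : ε y = -ε x) :
    etaRaise ε * bondPairAnn x y - bondPairAnn x y * etaRaise ε =
      (-((ε x : ℤ) : ℂ)) • bondCurrent x y := by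
  have h := congrArg conjTranspose (etaLower_commutator_bondPairCre ε x y hε)
  rw [conjTranspose_sub, conjTranspose_mul, conjTranspose_mul, conjTranspose_conjTranspose,
    etaLower, conjTranspose_conjTranspose, conjTranspose_smul, bondCurrent_conjTranspose] at h
  have hstar : star (-((ε x : ℤ) : ℂ)) = -((ε x : ℤ) : ℂ) := by
    rw [star_neg, star_intCast]
  rw [hstar, smul_neg] at h
  calc etaRaise ε * bondPairAnn x y - bondPairAnn x y * etaRaise ε
      = -(bondPairAnn x y * etaRaise ε - etaRaise ε * bondPairAnn x y) := by abel
    _ = (-((ε x : ℤ) : ℂ)) • bondCurrent x y := by rw [h, neg_neg]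

/-- **`[η⁺_ε, Δ_w] = -J_w` for a weighted bond family** (`b i = (x_i, y_i)` with
`ε_{y_i} = -ε_{x_i}`, weights `w i : ℂ`, e.g. a `d_{x²-y²}` form factor):
`Δ_w = Σ_i w_i d_{x_i y_i}`, `J_w = Σ_i (w_i ε_{x_i}) j_{x_i y_i}` — the companion of the tree's
`etaLower_commutator_weightedCurrent` (`[η⁻, J_w] = -2 Δ_w`). Zhang (1990); Markiewicz–Vaughn
(1998) p. 3. [cite: Zhang1990] -/
theorem etaRaise_commutator_weightedPair {β : Type*} (s : Finset β) (b : β → Λ × Λ)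
    (w : β → ℂ) (ε : Λ → ℤˣ) (hε : ∀ i ∈ s, ε (b i).2 = -ε (b i).1) :
    etaRaise ε * (∑ i ∈ s, w i • bondPairAnn (b i).1 (b i).2) -
        (∑ i ∈ s, w i • bondPairAnn (b i).1 (b i).2) * etaRaise ε =
      -(∑ i ∈ s, (w i * ((ε (b i).1 : ℤ) : ℂ)) • bondCurrent (b i).1 (b i).2) := by
  rw [Finset.mul_sum, Finset.sum_mul, ← Finset.sum_sub_distrib, ← Finset.sum_neg_distrib]
  refine Finset.sum_congr rfl fun i hi => ?_
  rw [mul_smul_comm, smul_mul_assoc, ← smul_sub, etaRaise_commutator_bondPairAnn ε _ _ (hε i hi),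
    smul_smul, ← neg_smul]
  congr 1
  ring

/-! ### §2 The selection rule in a pseudospin singlet -/

/-- `⟨η⁻ u, v⟩ = ⟨u, η⁺ v⟩`: Yang's `η` is the adjoint of `η†`. [cite: Yang1989, eq. (4)] -/
theorem star_etaLower_mulVec_dotProduct (ε : Λ → ℤˣ) (u v : Fock (Orb Λ)) :
    star (etaLower ε *ᵥ u) ⬝ᵥ v = star u ⬝ᵥ (etaRaise ε *ᵥ v) := by
  rw [etaLower, star_mulVec, conjTranspose_conjTranspose, dotProduct_mulVec]

/-- Lowering step on a vector with `η⁻ ψ = 0`: `η⁻ (J_w ψ) = -2 Δ_w ψ`. [cite: Zhang1990] -/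
theorem etaLower_mulVec_weightedCurrent_mulVec {β : Type*} (s : Finset β) (b : β → Λ × Λ)
    (w : β → ℂ) (ε : Λ → ℤˣ) (hε : ∀ i ∈ s, ε (b i).2 = -ε (b i).1) {ψ : Fock (Orb Λ)}
    (hlow : etaLower ε *ᵥ ψ = 0) :
    etaLower ε *ᵥ ((∑ i ∈ s, (w i * ((ε (b i).1 : ℤ) : ℂ)) • bondCurrent (b i).1 (b i).2) *ᵥ ψ) =
      (-2 : ℂ) • ((∑ i ∈ s, w i • bondPairAnn (b i).1 (b i).2) *ᵥ ψ) := by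
  have h' : etaLower ε * (∑ i ∈ s, (w i * ((ε (b i).1 : ℤ) : ℂ)) • bondCurrent (b i).1 (b i).2) =
      (∑ i ∈ s, (w i * ((ε (b i).1 : ℤ) : ℂ)) • bondCurrent (b i).1 (b i).2) * etaLower ε +
        (-2 : ℂ) • ∑ i ∈ s, w i • bondPairAnn (b i).1 (b i).2 :=
    eq_add_of_sub_eq' (etaLower_commutator_weightedCurrent s b w ε hε)
  rw [mulVec_mulVec, h', add_mulVec, ← mulVec_mulVec, hlow, mulVec_zero, zero_add, smul_mulVec]

/-- Raising step on a vector with `η⁺ ψ = 0`: `η⁺ (Δ_w ψ) = -J_w ψ`. [cite: Zhang1990] -/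
theorem etaRaise_mulVec_weightedPair_mulVec {β : Type*} (s : Finset β) (b : β → Λ × Λ)
    (w : β → ℂ) (ε : Λ → ℤˣ) (hε : ∀ i ∈ s, ε (b i).2 = -ε (b i).1) {ψ : Fock (Orb Λ)}
    (hhigh : etaRaise ε *ᵥ ψ = 0) :
    etaRaise ε *ᵥ ((∑ i ∈ s, w i • bondPairAnn (b i).1 (b i).2) *ᵥ ψ) =
      -((∑ i ∈ s, (w i * ((ε (b i).1 : ℤ) : ℂ)) • bondCurrent (b i).1 (b i).2) *ᵥ ψ) := by
  have h' : etaRaise ε * (∑ i ∈ s, w i • bondPairAnn (b i).1 (b i).2) =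
      (∑ i ∈ s, w i • bondPairAnn (b i).1 (b i).2) * etaRaise ε +
        -(∑ i ∈ s, (w i * ((ε (b i).1 : ℤ) : ℂ)) • bondCurrent (b i).1 (b i).2) :=
    eq_add_of_sub_eq' (etaRaise_commutator_weightedPair s b w ε hε)
  rw [mulVec_mulVec, h', add_mulVec, ← mulVec_mulVec, hhigh, mulVec_zero, zero_add, neg_mulVec]

/-- **Pseudospin selection rule for singlet-pair correlations** (the Wigner–Eckart content of
Zhang's triplet). In every pseudospin singlet `ψ` (`η⁻_ε ψ = 0` and `η⁺_ε ψ = 0`), for any two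
weighted bond families `(b, w)` on `s` and `(b', w')` on `s'` whose bonds join opposite staggered
signs:  `⟨Δ_w ψ, Δ_{w'} ψ⟩ = ½ ⟨J_w ψ, J_{w'} ψ⟩`,
`Δ_w = Σ_i w_i d_{x_i y_i}`, `J_w = Σ_i (w_i ε_{x_i}) j_{x_i y_i}`. Zhang, PRL 65 (1990) 120;
Yang–Zhang (1990) Theorem 1. [cite: Zhang1990] -/
theorem weightedPair_inner_eq_half_weightedCurrent_inner (ε : Λ → ℤˣ)
    {β : Type*} (s : Finset β) (b : β → Λ × Λ) (w : β → ℂ)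
    (hε : ∀ i ∈ s, ε (b i).2 = -ε (b i).1)
    {β' : Type*} (s' : Finset β') (b' : β' → Λ × Λ) (w' : β' → ℂ)
    (hε' : ∀ i ∈ s', ε (b' i).2 = -ε (b' i).1)
    {ψ : Fock (Orb Λ)} (hlow : etaLower ε *ᵥ ψ = 0) (hhigh : etaRaise ε *ᵥ ψ = 0) :
    star ((∑ i ∈ s, w i • bondPairAnn (b i).1 (b i).2) *ᵥ ψ) ⬝ᵥ
        ((∑ i ∈ s', w' i • bondPairAnn (b' i).1 (b' i).2) *ᵥ ψ) =
      (1 / 2 : ℂ) * (star ((∑ i ∈ s, (w i * ((ε (b i).1 : ℤ) : ℂ)) • bondCurrent (b i).1 (b i).2) *ᵥ ψ) ⬝ᵥ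
        ((∑ i ∈ s', (w' i * ((ε (b' i).1 : ℤ) : ℂ)) • bondCurrent (b' i).1 (b' i).2) *ᵥ ψ)) := by
  set Δ := ∑ i ∈ s, w i • bondPairAnn (b i).1 (b i).2 with hΔdef
  set J := ∑ i ∈ s, (w i * ((ε (b i).1 : ℤ) : ℂ)) • bondCurrent (b i).1 (b i).2 with hJdef
  set Δ' := ∑ i ∈ s', w' i • bondPairAnn (b' i).1 (b' i).2 with hΔ'def
  set J' := ∑ i ∈ s', (w' i * ((ε (b' i).1 : ℤ) : ℂ)) • bondCurrent (b' i).1 (b' i).2 with hJ'def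
  have hJ : etaLower ε *ᵥ (J *ᵥ ψ) = (-2 : ℂ) • (Δ *ᵥ ψ) :=
    etaLower_mulVec_weightedCurrent_mulVec s b w ε hε hlow
  have hJ' : etaLower ε *ᵥ (J' *ᵥ ψ) = (-2 : ℂ) • (Δ' *ᵥ ψ) :=
    etaLower_mulVec_weightedCurrent_mulVec s' b' w' ε hε' hlow
  have hup : etaRaise ε *ᵥ (Δ' *ᵥ ψ) = -(J' *ᵥ ψ) :=
    etaRaise_mulVec_weightedPair_mulVec s' b' w' ε hε' hhigh
  have hΔ : Δ *ᵥ ψ = (-1 / 2 : ℂ) • (etaLower ε *ᵥ (J *ᵥ ψ)) := by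
    rw [hJ, smul_smul]; norm_num
  have hΔ' : Δ' *ᵥ ψ = (-1 / 2 : ℂ) • (etaLower ε *ᵥ (J' *ᵥ ψ)) := by
    rw [hJ', smul_smul]; norm_num
  have hkey : etaRaise ε *ᵥ (etaLower ε *ᵥ (J' *ᵥ ψ)) = (2 : ℂ) • (J' *ᵥ ψ) := by
    rw [hJ', mulVec_smul, hup, smul_neg, ← neg_smul]; norm_num
  rw [hΔ, hΔ', star_smul, smul_dotProduct, dotProduct_smul, star_etaLower_mulVec_dotProduct, hkey,
    dotProduct_smul, smul_eq_mul, smul_eq_mul, smul_eq_mul]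
  have hs : star (-1 / 2 : ℂ) = -1 / 2 := by
    rw [show (-1 / 2 : ℂ) = ((-1 / 2 : ℝ) : ℂ) by push_cast; ring, Complex.star_def,
      Complex.conj_ofReal]
  rw [hs]
  ring

/-- **Bond form of the selection rule.** In every pseudospin singlet `ψ`, for bonds `(x, y)`,
`(x', y')` with `ε_y = -ε_x`, `ε_{y'} = -ε_{x'}`:
`⟨d_{xy} ψ, d_{x'y'} ψ⟩ = ½ ε_x ε_{x'} ⟨j_{xy} ψ, j_{x'y'} ψ⟩`. Zhang (1990). [cite: Zhang1990] -/
theorem bondPair_inner_eq_half_bondCurrent_inner (ε : Λ → ℤˣ) (x y x' y' : Λ)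
    (hε : ε y = -ε x) (hε' : ε y' = -ε x')
    {ψ : Fock (Orb Λ)} (hlow : etaLower ε *ᵥ ψ = 0) (hhigh : etaRaise ε *ᵥ ψ = 0) :
    star (bondPairAnn x y *ᵥ ψ) ⬝ᵥ (bondPairAnn x' y' *ᵥ ψ) =
      ((1 / 2 : ℂ) * (((ε x : ℤ) : ℂ) * ((ε x' : ℤ) : ℂ))) *
        (star (bondCurrent x y *ᵥ ψ) ⬝ᵥ (bondCurrent x' y' *ᵥ ψ)) := by
  have h := weightedPair_inner_eq_half_weightedCurrent_inner ε
    ({()} : Finset Unit) (fun _ => (x, y)) (fun _ => (1 : ℂ)) (fun _ _ => hε)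
    ({()} : Finset Unit) (fun _ => (x', y')) (fun _ => (1 : ℂ)) (fun _ _ => hε') hlow hhigh
  simp only [Finset.sum_singleton, one_smul, one_mul] at h
  rw [h, smul_mulVec, smul_mulVec, star_smul, smul_dotProduct, dotProduct_smul, smul_eq_mul,
    smul_eq_mul, star_intCast]
  ring

/-- **Expectation form.** In every pseudospin singlet `ψ`, for bonds joining opposite staggered
signs, `⟨ψ, d†_{xy} d_{x'y'} ψ⟩ = -½ ε_x ε_{x'} ⟨ψ, j_{xy} j_{x'y'} ψ⟩` (`j†_{xy} = -j_{xy}`): the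
singlet-pair two-point function is minus one half of the sublattice-staggered current two-point
function. Zhang (1990); Markiewicz–Vaughn (1998) p. 3. [cite: Zhang1990] -/
theorem expect_bondPairCre_mul_bondPairAnn (ε : Λ → ℤˣ) (x y x' y' : Λ)
    (hε : ε y = -ε x) (hε' : ε y' = -ε x')
    {ψ : Fock (Orb Λ)} (hlow : etaLower ε *ᵥ ψ = 0) (hhigh : etaRaise ε *ᵥ ψ = 0) :
    expect ((bondPairAnn x y)ᴴ * bondPairAnn x' y') ψ =
      (-(1 / 2 : ℂ) * (((ε x : ℤ) : ℂ) * ((ε x' : ℤ) : ℂ))) *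
        expect (bondCurrent x y * bondCurrent x' y') ψ := by
  unfold expect
  have h1 : star ψ ⬝ᵥ (((bondPairAnn x y)ᴴ * bondPairAnn x' y') *ᵥ ψ) =
      star (bondPairAnn x y *ᵥ ψ) ⬝ᵥ (bondPairAnn x' y' *ᵥ ψ) := by
    rw [← mulVec_mulVec, star_mulVec, ← dotProduct_mulVec]
  have h2 : star ψ ⬝ᵥ ((bondCurrent x y * bondCurrent x' y') *ᵥ ψ) =
      -(star (bondCurrent x y *ᵥ ψ) ⬝ᵥ (bondCurrent x' y' *ᵥ ψ)) := by
    rw [← mulVec_mulVec, star_mulVec, bondCurrent_conjTranspose, ← dotProduct_mulVec, neg_mulVec,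
      dotProduct_neg, neg_neg]
  rw [h1, h2, bondPair_inner_eq_half_bondCurrent_inner ε x y x' y' hε hε' hlow hhigh]
  ring

/-! ### §3 THE half-filled repulsive Hubbard ground state -/

variable {G : SimpleGraph Λ} [DecidableRel G.Adj]

/-- **Pair–pair = ½ current–current in THE half-filled repulsive Hubbard ground state** (weighted
bond families). Connected bipartite graph `G` on `Λ`, `A` one colour class with `|Aᶜ| = |A|`,
`t ≠ 0`, `U > 0`, `ε` alternating along the bonds of `G`, `ψ` THE ground state at `N = |Λ|`
(unique by Lieb's theorem; a pseudospin singlet by `HubbardHalfFilledPseudospinSinglet`). For bond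
families `(b, w)`, `(b', w')` whose bonds join opposite signs (they need not be bonds of `G`):
`⟨Δ_w ψ, Δ_{w'} ψ⟩ = ½ ⟨J_w ψ, J_{w'} ψ⟩`. Zhang (1990); Lieb (1989) Theorem 2.
[cite: Zhang1990] [cite: LiebPRL1989, proof of Theorem 2] -/
theorem groundState_weightedPair_inner_eq_half (hG : G.Connected) (A : Finset Λ)
    (hA : ∀ x y : Λ, G.Adj x y → (x ∈ A ↔ y ∉ A)) (hcard : Aᶜ.card = A.card)
    {t U : ℝ} (ht : t ≠ 0) (hU : 0 < U) (ε : Λ → ℤˣ) (hεG : ∀ x y : Λ, G.Adj x y → ε x = -ε y)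
    {ψ : Fock (Orb Λ)} (hψ : IsGroundState (hamiltonian G t U) (Fintype.card Λ) ψ)
    {β : Type*} (s : Finset β) (b : β → Λ × Λ) (w : β → ℂ)
    (hε : ∀ i ∈ s, ε (b i).2 = -ε (b i).1)
    {β' : Type*} (s' : Finset β') (b' : β' → Λ × Λ) (w' : β' → ℂ)
    (hε' : ∀ i ∈ s', ε (b' i).2 = -ε (b' i).1) :
    star ((∑ i ∈ s, w i • bondPairAnn (b i).1 (b i).2) *ᵥ ψ) ⬝ᵥ
        ((∑ i ∈ s', w' i • bondPairAnn (b' i).1 (b' i).2) *ᵥ ψ) =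
      (1 / 2 : ℂ) * (star ((∑ i ∈ s, (w i * ((ε (b i).1 : ℤ) : ℂ)) • bondCurrent (b i).1 (b i).2) *ᵥ ψ) ⬝ᵥ
        ((∑ i ∈ s', (w' i * ((ε (b' i).1 : ℤ) : ℂ)) • bondCurrent (b' i).1 (b' i).2) *ᵥ ψ)) := by
  obtain ⟨hlow, hhigh⟩ := eta_mulVec_eq_zero_of_isGroundState hG A hA hcard ht hU ε hεG hψ
  exact weightedPair_inner_eq_half_weightedCurrent_inner ε s b w hε s' b' w' hε' hlow hhigh

/-- **Bond form in THE half-filled repulsive Hubbard ground state**: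
`⟨ψ, d†_{xy} d_{x'y'} ψ⟩ = -½ ε_x ε_{x'} ⟨ψ, j_{xy} j_{x'y'} ψ⟩` for bonds `(x, y)`, `(x', y')`
joining opposite signs. Zhang (1990); Lieb (1989) Theorem 2. [cite: Zhang1990]
[cite: LiebPRL1989, proof of Theorem 2] -/
theorem groundState_expect_bondPairCre_mul_bondPairAnn (hG : G.Connected) (A : Finset Λ)
    (hA : ∀ x y : Λ, G.Adj x y → (x ∈ A ↔ y ∉ A)) (hcard : Aᶜ.card = A.card)
    {t U : ℝ} (ht : t ≠ 0) (hU : 0 < U) (ε : Λ → ℤˣ) (hεG : ∀ x y : Λ, G.Adj x y → ε x = -ε y)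
    {ψ : Fock (Orb Λ)} (hψ : IsGroundState (hamiltonian G t U) (Fintype.card Λ) ψ)
    (x y x' y' : Λ) (hε : ε y = -ε x) (hε' : ε y' = -ε x') :
    expect ((bondPairAnn x y)ᴴ * bondPairAnn x' y') ψ =
      (-(1 / 2 : ℂ) * (((ε x : ℤ) : ℂ) * ((ε x' : ℤ) : ℂ))) *
        expect (bondCurrent x y * bondCurrent x' y') ψ := by
  obtain ⟨hlow, hhigh⟩ := eta_mulVec_eq_zero_of_isGroundState hG A hA hcard ht hU ε hεG hψ
  exact expect_bondPairCre_mul_bondPairAnn ε x y x' y' hε hε' hlow hhigh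

end Hubbard

/-! ### §4 The even square torus `(ℤ/Lℤ)²`, `t' = 0`, half filling -/

section Torus

variable {L : ℕ} [NeZero L]

/-- **Torus form (weighted families, e.g. the `d_{x²-y²}` pair field vs. the staggered `d`-wave
current = `d`-density-wave operator).** `L` even, `t ≠ 0`, `U > 0`, `ψ` THE half-filled ground state
of `hamiltonian (fermionTorusGraph 2 L) t U` (`N = L²`), `ε = torusStagger`; for bond families
joining opposite stagger: `⟨Δ_w ψ, Δ_{w'} ψ⟩ = ½ ⟨J_w ψ, J_{w'} ψ⟩`. Zhang (1990); Lieb (1989).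
[cite: Zhang1990] [cite: LiebPRL1989, proof of Theorem 2] -/
theorem hubbardTorus_groundState_weightedPair_inner_eq_half (hL : Even L) {t U : ℝ} (ht : t ≠ 0)
    (hU : 0 < U) {ψ : Fock (Orb (FermionTorus 2 L))}
    (hψ : IsGroundState (hamiltonian (fermionTorusGraph 2 L) t U) (L ^ 2) ψ)
    {β : Type*} (s : Finset β) (b : β → FermionTorus 2 L × FermionTorus 2 L) (w : β → ℂ)
    (hε : ∀ i ∈ s, torusStagger (b i).2 = -torusStagger (b i).1)
    {β' : Type*} (s' : Finset β') (b' : β' → FermionTorus 2 L × FermionTorus 2 L) (w' : β' → ℂ)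
    (hε' : ∀ i ∈ s', torusStagger (b' i).2 = -torusStagger (b' i).1) :
    star ((∑ i ∈ s, w i • bondPairAnn (b i).1 (b i).2) *ᵥ ψ) ⬝ᵥ
        ((∑ i ∈ s', w' i • bondPairAnn (b' i).1 (b' i).2) *ᵥ ψ) =
      (1 / 2 : ℂ) *
        (star ((∑ i ∈ s, (w i * ((torusStagger (b i).1 : ℤ) : ℂ)) • bondCurrent (b i).1 (b i).2) *ᵥ ψ) ⬝ᵥ
          ((∑ i ∈ s', (w' i * ((torusStagger (b' i).1 : ℤ) : ℂ)) • bondCurrent (b' i).1 (b' i).2) *ᵥ ψ)) := by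
  obtain ⟨hlow, hhigh⟩ := (hubbardTorus_eta_mulVec_eq_zero_of_isGroundState hL ht hU hψ).1
  exact weightedPair_inner_eq_half_weightedCurrent_inner _ s b w hε s' b' w' hε' hlow hhigh

/-- **Torus bond form**: `L` even, `t ≠ 0`, `U > 0`, THE half-filled ground state `ψ`; for bonds
`(x, y)`, `(x', y')` of opposite stagger (e.g. nearest-neighbour bonds,
`torusStagger_eq_neg_of_adj_holds`):
`⟨ψ, d†_{xy} d_{x'y'} ψ⟩ = -½ ε_x ε_{x'} ⟨ψ, j_{xy} j_{x'y'} ψ⟩` — the benchmark singlet-pair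
correlator (any bond orientation pattern, hence any form factor: `d_{x²-y²}`, extended `s`, …)
is minus one half of the staggered bond-current correlator, with NO numerical input.
Zhang (1990); Lieb (1989). [cite: Zhang1990] [cite: LiebPRL1989, proof of Theorem 2] -/
theorem hubbardTorus_groundState_expect_bondPairCre_mul_bondPairAnn (hL : Even L) {t U : ℝ}
    (ht : t ≠ 0) (hU : 0 < U) {ψ : Fock (Orb (FermionTorus 2 L))}
    (hψ : IsGroundState (hamiltonian (fermionTorusGraph 2 L) t U) (L ^ 2) ψ)
    (x y x' y' : FermionTorus 2 L) (hε : torusStagger y = -torusStagger x)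
    (hε' : torusStagger y' = -torusStagger x') :
    expect ((bondPairAnn x y)ᴴ * bondPairAnn x' y') ψ =
      (-(1 / 2 : ℂ) * (((torusStagger x : ℤ) : ℂ) * ((torusStagger x' : ℤ) : ℂ))) *
        expect (bondCurrent x y * bondCurrent x' y') ψ := by
  obtain ⟨hlow, hhigh⟩ := (hubbardTorus_eta_mulVec_eq_zero_of_isGroundState hL ht hU hψ).1
  exact expect_bondPairCre_mul_bondPairAnn _ x y x' y' hε hε' hlow hhigh

omit [NeZero L] in
/-- Nearest-neighbour bonds of the even torus join opposite stagger, in the orientation used above.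
[cite: Yang1989, eq. (6)] -/
theorem torusStagger_snd_eq_neg_of_adj (hL : Even L) {x y : FermionTorus 2 L}
    (h : (fermionTorusGraph 2 L).Adj x y) : torusStagger y = -torusStagger x := by
  rw [torusStagger_eq_neg_of_adj_holds hL h, neg_neg]

end Torus

end Literature.MathematicalPhysics.QuantumLattice
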